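import Summits.QuantumFields.YangMills.Theorems.BalabanUVNodesK0RecordFormatNamesFluctF
import Summits.QuantumFields.YangMills.Theorems.BalabanUVNodesPortS1FlatLQt
import Literature.MathematicalPhysics.QuantumFieldTheory.Balaban1983to89.B15AveragingHolomorphic
import Literature.MathematicalPhysics.QuantumFieldTheory.Balaban1983to89.Node00.WilsonActionSecondVariation

/-!
# K0⁷ — THE RECORD-SIDE FORMAT NAMES, EDITION 29 = FLUCTUATION CARRIERS, SOCKET (o1-α): THE COMPLEXIFIED CONSTRAINT `Q̃` OF (2.4) — `pertC`, `recordQtC`, `recordLQtC`, `recordCtC`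
# (▶ porter PT-A-1 g9's located re-sizing of socket (o1) `D̃`, nodeO STATUS 2026-08-31 l.5715: «(o1-α) DEF-1 mints the complexified names `recordQtC∕recordLQtC∕recordCtC` over
# `avgMh ∘ (exp ∘ Σ z_a su2Gen a) · Vk`, real-slice bridge `recordQtC (x : ℝ-coords) = recordQt x`»; (o1-β)…(o1-ε) are the porter's on these names)

Cell `ym-nodeO-ideate` ∕ `ym-balaban-port`, DEFINER seat `ym-nodeO-def-1` (gen 39); `--kind definition --supports stmt-QuantumFields-20541 --as helper`; count-neutral.
[I] = [Balaban1987RG1].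

WHY.  Stage 2's socket (o1) is the linearising translation `D̃` of p.267; ▶ PT-A-1 located it as a TRANSPORT of lit's ✓`B12Lineariz267.exists_Dt` ∕ r09 g11's genuine chain onto the
record's (0.4) holomorphic one-step model ✓`B15AveragingHolomorphic.avgMh`, which needs `Q̃(V^{(k)}, ·)` of (2.4) as a function of COMPLEX fluctuation coordinates (ed.15's ✓`recordQt` is
the REAL chart through the `SU(2)`-valued average).  This file mints the complexified names; nothing else.

WHAT THIS FILE IS (definitions + bridges to the real chart; NEW names; ed.15 untouched):
* §24o `fluctMatC z b := Σ_a z(b,a) • su2Gen a` (complex coordinates; = ✓`fluctMat` on real `z`, `fluctMatC_ofReal`, `rfl`-grade); `pertC Vk z := (b ↦ exp(fluctMatC z b) · ↑Vk(b))` — the chart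
  (2.4) «V = V′V^{(k)}, V′ = exp(iB′)» as a COMPLEX MATRIX field (`pertC_ofReal : pertC Vk ↑x = ↑(pert Vk x)`, by ✓`exp_fluctMat_mem` + `suOfMat_of_mem`); ★ `recordQtC Vk z c :=
  mlog( avgMh (pertC Vk z) c · (↑(Ū(Vk) c))⋆ )` — `Q̃` through the HOLOMORPHIC average (junk SAID: `mlog` off the log-disc, `avgMh` adjugates off the guard); ★ bridge
  `recordQtC_ofReal (h : Small expMeanLogSU (pert Vk x) c) : recordQtC Vk ↑x c = recordQt Vk x c` (✓`coe_avgFun_eq_avgMh` at the perturbed field + ✓`coe_inv_SU`); `recordQtC_zero`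
  (`= 0` at `z = 0` under `Small expMeanLogSU Vk c`); `recordLQtC Vk := fderiv ℂ (recordQtC Vk) 0` («L is a linear transformation», p.267, now ℂ-linear); ★ `recordCtC Vk z := recordQtC Vk z
  − recordLQtC Vk z` (print's `C̃`, the input of `exists_Dt`) + `recordLQtC_add_recordCtC` (`rfl`-grade).
NOT HERE ((o1-β)–(o1-ε), ▶ PT-A-1's on ★★★'s word): analyticity of `z ↦ recordQtC z c` on a k-uniform polydisc, `QuadAnalytic recordCtC C₂ R`, the `‖hopLinGraph‖` bound, the
instantiation of `exists_Dt`; nor the identification `recordLQtC ∘ ofReal = ↑recordLQt` (needs ℂ- vs ℝ-differentiability of the two charts — (o1-β) content).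

HONEST FRAMING.  Definitions and two bridges; NOTHING of Bałaban is asserted, ported or discharged; `recordFluctInt`, (o1), (o3) NOT in the tree; `stub_FE` (XXL) ∕ `stub_P0C` OPEN,
⟨27930⟩ OPEN (1∕3); K0⁷ ∕ K0ᴬ ∕ K1ᴬ ∕ K3ᴬ OPEN; NODE O 0∕1; COUNT 8∕28 · K 1∕4 UNMOVED; finite `𝕋⁴_{L^K}` at fixed ε — NOT continuum ∕ ℝ⁴ ∕ OS; **the Yang–Mills mass gap (Clay)
is NOT proved by any of this.**  No `sorry`, `instance`, `notation`; standard axioms.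
-/

noncomputable section

open scoped BigOperators Matrix.Norms.L2Operator

namespace Summit.QuantumFields.YangMills.Theorems.K0RecordFormatNames

open Literature.MathematicalPhysics.QuantumFieldTheory.Balaban1983to89
open Literature.MathematicalPhysics.QuantumFieldTheory.Balaban1983to89.Node00
open Literature.MathematicalPhysics.QuantumFieldTheory.Balaban1983to89.T4Continuum (T4Family)
open NormedSpace (exp)
open BlockAveraging
open B15AveragingHolomorphic (avgMh avgMh_coeField coe_avgFun_eq_avgMh)
open ExpMeanLog (expMeanLogSU)
open Summit.QuantumFields.YangMills.Theorems.BalabanUVNodesPortS1 (exp_fluctMat_mem pert_zero fluctMat_zero)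

variable (F : T4Family)

/-! ## §24o  The complexified chart and constraint -/

/-- **Complex fluctuation coordinates → matrices**: `fluctMatC F k K z b := Σ_a z(b,a) • su2Gen a` (ed.15's `fluctMat` with `z : FluctIdx → ℂ`; for real `z` it is `𝔰𝔲(2)`-valued, in
general `𝔰𝔩(2,ℂ)`-valued — print's `𝔤ᶜ`). [cite: Balaban1987RG1, (2.4) p.266; Balaban1985Variational, (51) p.286] -/
def fluctMatC (k K : ℕ) (z : FluctIdx F k K → ℂ) (b : PBond (F.P K) k) : MatA 2 := ∑ a, z (b, a) • su2Gen a

/-- On real coordinates `fluctMatC` IS ed.15's `fluctMat` (`rfl`). [cite: Balaban1987RG1, (2.4) p.266 (bookkeeping)] -/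
theorem fluctMatC_ofReal (k K : ℕ) (x : FluctIdx F k K → ℝ) (b : PBond (F.P K) k) :
    fluctMatC F k K (fun i => (x i : ℂ)) b = fluctMat F k K x b := rfl

/-- `fluctMatC 0 = 0`. [cite: Balaban1987RG1, (2.4) p.266 (bookkeeping)] -/
theorem fluctMatC_zero (k K : ℕ) (b : PBond (F.P K) k) : fluctMatC F k K 0 b = 0 := by
  simp [fluctMatC]

/-- ★ **THE CHART (2.4) AS A COMPLEX MATRIX FIELD**: `pertC F k K Vk z := (b ↦ exp(fluctMatC z b) · ↑Vk(b))` — «V = V′V^{(k)}, V′ = exp(iB′)» with COMPLEX `B′`; for real `z` it is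
the coercion of ed.15's `SU(2)`-valued `pert` (`pertC_ofReal`). [cite: Balaban1987RG1, (2.4) p.266; Balaban1985Variational, (51) p.286] -/
def pertC (k K : ℕ) (Vk : GaugeField (F.P K) k (SU 2)) (z : FluctIdx F k K → ℂ) : PBond (F.P K) k → MatA 2 :=
  fun b => exp (fluctMatC F k K z b) * ((Vk b : SU 2) : MatA 2)

/-- ★ BRIDGE: on real coordinates the complex chart is the coercion of ed.15's chart, `pertC Vk ↑x = ↑(pert Vk x)`. [cite: Balaban1987RG1, (2.4) p.266 (bookkeeping)] -/
theorem pertC_ofReal (k K : ℕ) (Vk : GaugeField (F.P K) k (SU 2)) (x : FluctIdx F k K → ℝ) :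
    pertC F k K Vk (fun i => (x i : ℂ)) = coeField (pert F k K Vk x) := by
  funext b
  rw [pertC, fluctMatC_ofReal, coeField_apply, pert, suOfMat_of_mem (exp_fluctMat_mem F k K x b)]
  rfl

/-- At `z = 0` the complex chart sits at the background: `pertC Vk 0 = ↑Vk`. [cite: Balaban1987RG1, (2.4) p.266 (bookkeeping)] -/
theorem pertC_zero (k K : ℕ) (Vk : GaugeField (F.P K) k (SU 2)) : pertC F k K Vk 0 = coeField Vk := by
  funext b
  rw [pertC, fluctMatC_zero, NormedSpace.exp_zero, one_mul, coeField_apply]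

/-- ★★ **THE COMPLEXIFIED CONSTRAINT `Q̃(V^{(k)}, B′)`**: `recordQtC F k K Vk z c := mlog( avgMh (pertC Vk z) c · (↑(Ū(Vk) c))⋆ )` — (2.4)'s «log(M(V′V^{(k)})M(V^{(k)})⁻¹)» with the
HOLOMORPHIC one-step average ✓`B15AveragingHolomorphic.avgMh` (adjugates on backward steps; = the genuine average on guarded `SU(2)` fields) and the power-series `mlog`.  JUNK (said): off
the log-disc `mlog` is the series' value, off the guard `avgMh` is not the average. [cite: Balaban1987RG1, (2.4) p.266, p.267, (0.4) p.253] -/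
def recordQtC (k K : ℕ) (Vk : GaugeField (F.P K) k (SU 2)) (z : FluctIdx F k K → ℂ) : PBond (F.P K) (k + 1) → MatA 2 :=
  fun c => MatrixLog.mlog (avgMh (pertC F k K Vk z) c * star (((avOfRecord F 2 K k).avg Vk c : SU 2) : MatA 2))

/-- Unfolding (`rfl`). [cite: Balaban1987RG1, (2.4) p.266 (bookkeeping)] -/
theorem recordQtC_apply (k K : ℕ) (Vk : GaugeField (F.P K) k (SU 2)) (z : FluctIdx F k K → ℂ) (c : PBond (F.P K) (k + 1)) :
    recordQtC F k K Vk z c = MatrixLog.mlog (avgMh (pertC F k K Vk z) c * star (((avOfRecord F 2 K k).avg Vk c : SU 2) : MatA 2)) := rfl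

/-- ★ BRIDGE TO THE REAL CHART: under the small-field guard at the perturbed field (so that the holomorphic average IS the average, ✓`coe_avgFun_eq_avgMh`),
`recordQtC Vk ↑x c = recordQt Vk x c`. [cite: Balaban1987RG1, (2.4) p.266, (0.4) p.253] -/
theorem recordQtC_ofReal (k K : ℕ) (Vk : GaugeField (F.P K) k (SU 2)) (x : FluctIdx F k K → ℝ) (c : PBond (F.P K) (k + 1))
    (h : Small expMeanLogSU (pert F k K Vk x) c) :
    recordQtC F k K Vk (fun i => (x i : ℂ)) c = recordQt F k K Vk x c := by
  rw [recordQtC_apply, pertC_ofReal]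
  have havg : avgMh (coeField (pert F k K Vk x)) c = (((avOfRecord F 2 K k).avg (pert F k K Vk x) c : SU 2) : MatA 2) :=
    (coe_avgFun_eq_avgMh (pert F k K Vk x) c h).symm
  rw [havg, ← coe_inv_SU, ← Submonoid.coe_mul]
  rfl

/-- `Q̃(V^{(k)}, 0) = 0` under the guard at `Vk` (the quotient is `1`, `mlog 1 = 0`). [cite: Balaban1987RG1, p.267] -/
theorem recordQtC_zero (k K : ℕ) (Vk : GaugeField (F.P K) k (SU 2)) (c : PBond (F.P K) (k + 1)) (h : Small expMeanLogSU Vk c) :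
    recordQtC F k K Vk 0 c = 0 := by
  rw [recordQtC_apply, pertC_zero, ← coe_avgFun_eq_avgMh Vk c h]
  change MatrixLog.mlog ((((avOfRecord F 2 K k).avg Vk c : SU 2) : MatA 2) * star (((avOfRecord F 2 K k).avg Vk c : SU 2) : MatA 2)) = 0
  rw [coe_mul_star_coe_SU, MatrixLog.mlog_one]

/-- **`LQ̃` complexified**: `recordLQtC F k K Vk := fderiv ℂ (recordQtC F k K Vk) 0` — «L is a linear transformation» (p.267), now ℂ-linear on complex coordinates. [cite: Balaban1987RG1, p.267] -/
def recordLQtC (k K : ℕ) (Vk : GaugeField (F.P K) k (SU 2)) : (FluctIdx F k K → ℂ) →L[ℂ] (PBond (F.P K) (k + 1) → MatA 2) :=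
  fderiv ℂ (recordQtC F k K Vk) 0

/-- ★ **`C̃` complexified**: `recordCtC F k K Vk z := recordQtC Vk z − recordLQtC Vk z` — the NON-LINEAR PART of the constraint, the input `Ct` of lit's ✓`B12Lineariz267.exists_Dt`.
[cite: Balaban1987RG1, p.267, (1.5) p.261] -/
def recordCtC (k K : ℕ) (Vk : GaugeField (F.P K) k (SU 2)) (z : FluctIdx F k K → ℂ) : PBond (F.P K) (k + 1) → MatA 2 :=
  recordQtC F k K Vk z - recordLQtC F k K Vk z

/-- FACE: `Q̃ = LQ̃ + C̃` pointwise (by construction). [cite: Balaban1987RG1, p.267 (bookkeeping)] -/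
theorem recordLQtC_add_recordCtC (k K : ℕ) (Vk : GaugeField (F.P K) k (SU 2)) (z : FluctIdx F k K → ℂ) :
    recordLQtC F k K Vk z + recordCtC F k K Vk z = recordQtC F k K Vk z := by
  rw [recordCtC, add_sub_cancel]

end Summit.QuantumFields.YangMills.Theorems.K0RecordFormatNames

end
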